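import Summits.CriticalPhenomena.Ising3DConformalLimit.Theses.PositivityBegetsConformality
import Literature.Probability.LatticeModels.InversionPositivity
import HarnessLib

/-!
# Crux `InversionPositiveLimit` (stmt-CriticalPhenomena-4671): the normalisation hypothesis is idle

Route `PositivityBegetsConformality`, sub-problem `Ising3DConformalLimit`; theorem-only file,
`--supports stmt-CriticalPhenomena-4671` (lead c5).

The crux carries the hypothesis `∀ n z, z ∉ NonCoincident 3 n → S n z = 0` ((H3), "normalised off
`NonCoincident`").  For the COVARIANCE item 1982 `InversionUpgradeNormalised` this hypothesis is
load-bearing (`InversionUpgradeNormalisedNegative.not_cruxWithoutNormalisation`: the conclusion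
`IsInversionCovariant Δ S` quantifies over coincident configurations too, where a pointwise limit
controls nothing).  For the POSITIVITY crux it is IDLE: the radial Osterwalder–Schrader Gram matrices
only evaluate `S` at juxtapositions `X_a ⊔ ιX_b` of admissible configurations, which are injective
(`append_inversion_mem_nonCoincident`), so `IsInversionPositive Δ` does not see the values of `S` on the
coincident locus (`isInversionPositive_congr_nonCoincident`), while every other hypothesis of the crux
survives normalising `S` off `NonCoincident`.  Hence

* `inversionPositiveLimit_iff_withoutNormalisation` — the crux is EQUIVALENT to the same statement with
  (H3) deleted.

So the kernel-checked equivalence crux 4671 ⟺ item 1982 (p141302) reads: 1982 ⟺ "(IP) for every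
non-degenerate translation-invariant scale-covariant pointwise limit of `criticalCorr 3`, normalised or
not".  No definitions, no `sorry`.
-/

noncomputable section

namespace Summit.CriticalPhenomena.Ising3DConformalLimit.InversionPositiveLimitNegative

open Literature.Probability.LatticeModels
open Filter Set Function EuclideanGeometry
open scoped Topology

/-- **Inversion positivity only sees non-coincident values.** Two families that agree on injective
configurations are inversion positive with weight `Δ` simultaneously: the Gram matrices coincide,
admissible juxtapositions being injective (`append_inversion_mem_nonCoincident`). [folklore] -/
theorem isInversionPositive_congr_nonCoincident {d : ℕ} {Δ : ℝ} {S T : CorrFamily d}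
    (h : ∀ n (z : Fin n → EuclideanSpace ℝ (Fin d)), Function.Injective z → S n z = T n z) :
    IsInversionPositive Δ S ↔ IsInversionPositive Δ T := by
  have key : ∀ {S T : CorrFamily d},
      (∀ n (z : Fin n → EuclideanSpace ℝ (Fin d)), Function.Injective z → S n z = T n z) →
      IsInversionPositive Δ S → IsInversionPositive Δ T := by
    intro S T h hS m k X hX hinj
    have e : (Matrix.of fun a b : Fin m => (∏ i, ‖X b i‖ ^ (-(2 * Δ))) *
        T (k a + k b) (Fin.append (X a) (fun i => inversion 0 1 (X b i)))) =
        Matrix.of fun a b : Fin m => (∏ i, ‖X b i‖ ^ (-(2 * Δ))) *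
          S (k a + k b) (Fin.append (X a) (fun i => inversion 0 1 (X b i))) := by
      ext a b
      simp only [Matrix.of_apply]
      rw [h _ _ (append_inversion_injective hX hinj a b)]
    rw [e]
    exact hS m k X hX hinj
  exact ⟨key h, key fun n z hz => (h n z hz).symm⟩

/-- **(H3) is idle: the crux is equivalent to itself with the normalisation hypothesis deleted.**
`(⇐)` drops (H3); `(⇒)` normalises a given limit `S` off `NonCoincident`
(`S' n z = S n z` if `z` is injective, `0` otherwise): `S'` is again a pointwise limit of
`criticalCorr 3` (the limit is taken on `NonCoincident` only), non-degenerate, translation invariant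
and scale covariant, so the crux makes `S'` inversion positive, and `S`, agreeing with `S'` on injective
configurations, is inversion positive with it (`isInversionPositive_congr_nonCoincident`). [folklore] -/
theorem inversionPositiveLimit_iff_withoutNormalisation :
    Summit.CriticalPhenomena.Ising3DConformalLimit.Theses.PositivityBegetsConformality.InversionPositiveLimit ↔
      ∀ (ρ : ℝ → ℝ) (Δ : ℝ) (S : CorrFamily 3), (∀ δ ∈ Set.Ioc (0:ℝ) 1, 0 < ρ δ) →
        HasPointwiseScalingLimit (criticalCorr 3) ρ S → IsNondegenerateTwoPoint S →
        IsTranslationInvariant S → IsScaleCovariant Δ S → IsInversionPositive Δ S := by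
  classical
  constructor
  · intro hcrux ρ Δ S hρ hlim hnd htr hsc
    let S' : CorrFamily 3 := fun n z => if Function.Injective z then S n z else 0
    have S'_of_inj : ∀ {n : ℕ} {z : Fin n → EuclideanSpace ℝ (Fin 3)}, Function.Injective z →
        S' n z = S n z := fun hz => by simp [S', hz]
    have S'_of_not : ∀ {n : ℕ} {z : Fin n → EuclideanSpace ℝ (Fin 3)}, ¬ Function.Injective z →
        S' n z = 0 := fun hz => by simp [S', hz]
    have hlim' : HasPointwiseScalingLimit (criticalCorr 3) ρ S' :=
      fun n => (hlim n).congr_right fun z hz => (S'_of_inj hz).symm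
    have hnorm' : ∀ n z, z ∉ NonCoincident 3 n → S' n z = 0 := fun n z hz => S'_of_not hz
    have hnd' : IsNondegenerateTwoPoint S' := fun z hz => by rw [S'_of_inj hz]; exact hnd z hz
    have htr' : IsTranslationInvariant S' := by
      intro n v z
      by_cases hz : Function.Injective z
      · have hz' : Function.Injective (fun i => z i + v) := (add_left_injective v).comp hz
        rw [S'_of_inj hz, S'_of_inj hz', htr n v z]
      · have hz' : ¬ Function.Injective (fun i => z i + v) :=
          fun h => hz ((add_left_injective v).of_comp_iff _ |>.1 h)
        rw [S'_of_not hz, S'_of_not hz']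
    have hsc' : IsScaleCovariant Δ S' := by
      intro n c hc z
      by_cases hz : Function.Injective z
      · have hz' : Function.Injective (fun i => c • z i) := (smul_right_injective _ hc.ne').comp hz
        rw [S'_of_inj hz, S'_of_inj hz', hsc n c hc z]
      · have hz' : ¬ Function.Injective (fun i => c • z i) :=
          fun h => hz ((smul_right_injective _ hc.ne').of_comp_iff _ |>.1 h)
        rw [S'_of_not hz, S'_of_not hz', mul_zero]
    have hIP' : IsInversionPositive Δ S' := hcrux ρ Δ S' hρ hlim' hnorm' hnd' htr' hsc'
    exact (isInversionPositive_congr_nonCoincident fun n z hz => S'_of_inj hz).1 hIP'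
  · intro h ρ Δ S hρ hlim _ hnd htr hsc
    exact h ρ Δ S hρ hlim hnd htr hsc

end Summit.CriticalPhenomena.Ising3DConformalLimit.InversionPositiveLimitNegative

end
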